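import Summits.BirchSwinnertonDyer.BirchSwinnertonDyer.Theorems.ThetaPartnerAtTwoSignedControlAtTwoPlusGenStepTwo
import HarnessLib

/-!
# The PLUS tower at `2`, VI: GALOIS DESCENT `Λ(Q) ∈ ℚ₂(v_N) ⇒ Q ∈ E(ℚ₂(v_N))` along `ℚ₂(v_{N+1}) ⊃ ℚ₂(v_N)`, and the
# generation step with descent: `P ≡ B + 2•R (mod E₁(ℚ₂(v_N)))`
# (K4 `SignedControlAtTwo`, stmt-BirchSwinnertonDyer-20309, line `eulerchar` v6, stub HONDA⁺@2 (GEN) — memo LAGPLUS-AT-2 §4 (ii),(v))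

Route `ThetaPartnerAtTwo` (TP2; crux shared with `ResidualThetaTransportAtTwo`), crux K4, lead seat `prover-bsd-wall-tp2-p3` (g2).
Sequel of `…PlusGenStepTwo` (V). Notation as there: `v_N = ζ_{2^N} + ζ_{2^N}⁻¹ − 2`, `k = ℚ₂(v_N) ⊂ k' = ℚ₂(v_{N+1})`, `N ≥ 2`,
`E = genFibΩ 2 M`, `E₁ = kernel`, `Λ = ptLogΩ`, `L(F)` = points with coordinates in `F`; `τ` = the automorphism with
`τ ζ_{2^{N+1}} = −ζ_{2^{N+1}}⁻¹` (`PlusTower.exists_tau`): it fixes `k` and maps `v_{N+1} ↦ −4 − v_{N+1}`.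

WHAT.
* §1 field descent: `exists_pow_two_mul_norm_le_one`, `exists_eq_add_mul_v_succ_of_mem` (`k' = k + k·v_{N+1}`),
  `tau_apply_eq_self_of_mem` (`τ|_k = id`), `v_succ_ne_neg_two`, **`mem_adjoin_v_of_tau_apply_eq`** (`x ∈ k'`, `τx = x ⇒ x ∈ k`);
* §2 point descent: **`mem_subfieldPoints_adjoin_v_of_ptLogΩ_mem`** — `Q ∈ L(k') ∩ E₁` with `Λ(Q) ∈ k` lies in `L(k)`, given no
  `2`-power torsion in `L(ℚ₂(ζ_{2^{N+1}}))` (the plus analogue of `KobayashiTowerPoints.mem_subfieldPoints_of_ptLogΩ_mem`: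
  `Λ(τQ − Q) = τΛ(Q) − Λ(Q) = 0`, so `τQ − Q` is `2`-power torsion, so `τQ = Q`, so the coordinates of `Q` are `τ`-fixed);
* §3 **`exists_sub_closure_sub_two_smul_mem_plus`** — THE GENERATION STEP WITH DESCENT: for a plus Honda point `e ∈ L(k') ∩ E₁`
  (`Λ(e) − v_{N+1} ∈ k`) and every `P ∈ L(k') ∩ E₁`: `P − B − 2•R ∈ L(k) ∩ E₁` for some `B ∈ ℤ[Γ·e]`, `R ∈ L(k') ∩ E₁` — Kobayashi's
  «`Ê(𝔪_n) = C(𝔪_n) + Ê(𝔪_{n−1}) (mod p)`» for the PLUS tower at `p = 2` (clause (GEN) of HONDA⁺@2 in `Ω`-currency, modulo the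
  dictionary `localLayerPointsOfEmb κ ι W n ↔ L(ℚ₂(v_{n+2}))` being typed by seat w2).
HONEST FRAMING: THEOREMS ONLY (no definition, no named fact, no instance, no `sorry`); pure local theory in `ℚ̄₂`; nothing about any
Selmer group; closes no item; BSD is not proved by any of this.

References: [Kobayashi2003] §8.4, Props. 8.11–8.12; [Washington1997] §13.1; [SilvermanAEC2009] VII.2.2.
-/

set_option autoImplicit false
-- the Theorems namespace of this sub repeats the summit name by design (D-0017 nested layout)
set_option linter.dupNamespace false

noncomputable section

open scoped Classical Topology NNReal IntermediateField
open Filter PowerSeries Finset Polynomial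

namespace Summit.BirchSwinnertonDyer.BirchSwinnertonDyer.Theorems.SignedEC.PlusTower

open Literature.RingTheory.FormalGroups WeierstrassCurve Field Field.absoluteGaloisGroup
open Summit.BirchSwinnertonDyer.Rank1Residual.Additive
open Summit.BirchSwinnertonDyer.Rank1Residual.Additive.PadicCyclotomicTower
open Summit.BirchSwinnertonDyer.Rank1Residual.Additive.HondaFss
open Summit.BirchSwinnertonDyer.Rank1Residual.Additive.BallEval
open Literature.NumberTheory.GaloisRepresentations.LubinTate (unitBall mem_unitBall_iff)
open Literature.NumberTheory.EllipticCurves Literature.NumberTheory.EllipticCurves.FormalGroupChart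
open Summit.BirchSwinnertonDyer.BirchSwinnertonDyer.Theorems.SignedKatoOffTwo.LocalAllPrimes
open Summit.BirchSwinnertonDyer.BirchSwinnertonDyer.Theorems.SignedEC.OmegaSubfield

/-! ## §1 Field descent along `k' ⊃ k` -/

/-- Every `x ∈ ℚ̄₂` becomes integral after multiplication by a power of `2`. [folklore] -/
theorem exists_pow_two_mul_norm_le_one (x : PadicAlgCl 2) : ∃ n : ℕ, ‖(2 : PadicAlgCl 2) ^ n * x‖ ≤ 1 := by
  by_cases hx : x = 0
  · exact ⟨0, by rw [hx, mul_zero, norm_zero]; exact zero_le_one⟩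
  have h2 := Literature.NumberTheory.GaloisRepresentations.PadicAlgCl.norm_natCast_prime_pos_lt_one (p := 2)
  have h2' : ‖(2 : PadicAlgCl 2)‖ < 1 := by exact_mod_cast h2.2
  have hxpos : 0 < ‖x‖⁻¹ := inv_pos.mpr (norm_pos_iff.mpr hx)
  obtain ⟨n, hn⟩ := exists_pow_lt_of_lt_one hxpos h2'
  refine ⟨n, ?_⟩
  rw [norm_mul, norm_pow]
  have h := mul_lt_mul_of_pos_right hn (norm_pos_iff.mpr hx)
  rw [inv_mul_cancel₀ (norm_ne_zero_iff.mpr hx)] at h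
  exact h.le

/-- **`k' = k + k·v_{N+1}`** (`N ≥ 2`): every `x ∈ ℚ₂(v_{N+1})` is `a + b·v_{N+1}` with `a, b ∈ ℚ₂(v_N)` (integral decomposition of
`2^n x`, file IV). [folklore] -/
theorem exists_eq_add_mul_v_succ_of_mem {N : ℕ} (hN : 2 ≤ N) {x : PadicAlgCl 2}
    (hx : x ∈ ℚ_[2]⟮zeta 2 (N + 1) + (zeta 2 (N + 1))⁻¹ - 2⟯) :
    ∃ a ∈ ℚ_[2]⟮zeta 2 N + (zeta 2 N)⁻¹ - 2⟯, ∃ b ∈ ℚ_[2]⟮zeta 2 N + (zeta 2 N)⁻¹ - 2⟯,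
      x = a + b * (zeta 2 (N + 1) + (zeta 2 (N + 1))⁻¹ - 2) := by
  set K := ℚ_[2]⟮zeta 2 N + (zeta 2 N)⁻¹ - 2⟯ with hK
  set K' := ℚ_[2]⟮zeta 2 (N + 1) + (zeta 2 (N + 1))⁻¹ - 2⟯ with hK'
  obtain ⟨n, hn⟩ := exists_pow_two_mul_norm_le_one x
  have h2K' : (2 : PadicAlgCl 2) ^ n ∈ K' := pow_mem (by exact_mod_cast IntermediateField.natCast_mem K' 2) n
  have h2K : (2 : PadicAlgCl 2) ^ n ∈ K := pow_mem (by exact_mod_cast IntermediateField.natCast_mem K 2) n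
  obtain ⟨a, ⟨haK, -⟩, b, ⟨hbK, -⟩, hab⟩ := exists_eq_add_mul_v_succ hN (mul_mem h2K' hx) hn
  have h20 : (2 : PadicAlgCl 2) ^ n ≠ 0 := pow_ne_zero _ two_ne_zero
  refine ⟨((2 : PadicAlgCl 2) ^ n)⁻¹ * a, mul_mem (inv_mem h2K) haK, ((2 : PadicAlgCl 2) ^ n)⁻¹ * b,
    mul_mem (inv_mem h2K) hbK, ?_⟩
  have hx' : x = ((2 : PadicAlgCl 2) ^ n)⁻¹ * ((2 : PadicAlgCl 2) ^ n * x) := by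
    rw [← mul_assoc, inv_mul_cancel₀ h20, one_mul]
  rw [hx', hab]
  ring

/-- **`τ` fixes `k = ℚ₂(v_N)` pointwise** (`N ≥ 2`; `τ(u_N) = u_N`, file I). [cite: Washington1997, §13.1] -/
theorem tau_apply_eq_self_of_mem {N : ℕ} (hN : 2 ≤ N) {τ : PadicAlgCl 2 ≃ₐ[ℚ_[2]] PadicAlgCl 2}
    (hτ : τ (zeta 2 (N + 1)) = zeta 2 (N + 1) ^ (2 ^ N + (2 ^ (N + 1) - 1))) {y : PadicAlgCl 2}
    (hy : y ∈ ℚ_[2]⟮zeta 2 N + (zeta 2 N)⁻¹ - 2⟯) : τ y = y := by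
  have hv : τ (zeta 2 N + (zeta 2 N)⁻¹ - 2) = zeta 2 N + (zeta 2 N)⁻¹ - 2 := by
    rw [map_sub, map_ofNat, tau_u hτ]
  obtain ⟨r, -, rfl⟩ := exists_aeval_v_eq hN hy
  conv_rhs => rw [aeval_eq_sum_range]
  rw [aeval_eq_sum_range, map_sum]
  refine Finset.sum_congr rfl fun i _ ↦ ?_
  rw [Algebra.smul_def, map_mul, map_pow, AlgEquiv.commutes, hv]

/-- `v_{N+1} ≠ −2` for `N ≥ 2` (`‖v_{N+1}‖^{2^{N−1}} = ‖2‖` and `‖2‖^{2^{N−1}} < ‖2‖`). [folklore] -/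
theorem v_succ_ne_neg_two {N : ℕ} (hN : 2 ≤ N) : zeta 2 (N + 1) + (zeta 2 (N + 1))⁻¹ - 2 ≠ -2 := by
  intro h
  have hpow := norm_v_pow_eq (by omega : 2 ≤ N + 1)
  rw [h, norm_neg, show N + 1 - 2 = N - 1 by omega] at hpow
  have h2 := Literature.NumberTheory.GaloisRepresentations.PadicAlgCl.norm_natCast_prime_pos_lt_one (p := 2)
  have h2pos : 0 < ‖(2 : PadicAlgCl 2)‖ := by exact_mod_cast h2.1
  have h2lt : ‖(2 : PadicAlgCl 2)‖ < 1 := by exact_mod_cast h2.2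
  have hlt : ‖(2 : PadicAlgCl 2)‖ ^ 2 ^ (N - 1) < ‖(2 : PadicAlgCl 2)‖ := by
    refine pow_lt_self_of_lt_one₀ h2pos h2lt ?_
    have : 2 ≤ 2 ^ (N - 1) := by
      calc 2 = 2 ^ 1 := (pow_one 2).symm
        _ ≤ 2 ^ (N - 1) := Nat.pow_le_pow_right (by norm_num) (by omega)
    omega
  exact absurd hpow hlt.ne

/-- **Field descent**: `x ∈ k' = ℚ₂(v_{N+1})` with `τx = x` lies in `k = ℚ₂(v_N)` (`N ≥ 2`): `x = a + bv'`,
`τx = a + b(−4 − v')`, so `b(2v' + 4) = 0`, `b = 0`. [cite: Washington1997, §13.1] -/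
theorem mem_adjoin_v_of_tau_apply_eq {N : ℕ} (hN : 2 ≤ N) {τ : PadicAlgCl 2 ≃ₐ[ℚ_[2]] PadicAlgCl 2}
    (hτ : τ (zeta 2 (N + 1)) = zeta 2 (N + 1) ^ (2 ^ N + (2 ^ (N + 1) - 1))) {x : PadicAlgCl 2}
    (hx : x ∈ ℚ_[2]⟮zeta 2 (N + 1) + (zeta 2 (N + 1))⁻¹ - 2⟯) (hfix : τ x = x) :
    x ∈ ℚ_[2]⟮zeta 2 N + (zeta 2 N)⁻¹ - 2⟯ := by
  obtain ⟨a, ha, b, hb, rfl⟩ := exists_eq_add_mul_v_succ_of_mem hN hx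
  have hτv' := tau_v_succ (by omega : 1 ≤ N) hτ
  set v' := zeta 2 (N + 1) + (zeta 2 (N + 1))⁻¹ - 2 with hv'
  rw [map_add, map_mul, tau_apply_eq_self_of_mem hN hτ ha, tau_apply_eq_self_of_mem hN hτ hb, hτv'] at hfix
  have hb0 : b * (2 * (v' + 2)) = 0 := by linear_combination -hfix
  rcases mul_eq_zero.mp hb0 with hb0 | hv0
  · rw [hb0, zero_mul, add_zero]; exact ha
  · exfalso
    rcases mul_eq_zero.mp hv0 with h2 | hv2
    · exact two_ne_zero h2
    · exact v_succ_ne_neg_two hN (by linear_combination hv2)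

/-! ## §2 Point descent: `Λ(Q) ∈ k ⇒ Q ∈ L(k)` -/

section Descent

variable {M : WeierstrassCurve ℤ_[2]} [hE : (M.map PadicInt.Coe.ringHom).IsElliptic]
  [hintΩ : (genFibΩ 2 M).IsIntegral (Valued.v (R := PadicAlgCl 2)).integer]

omit hE hintΩ in
/-- A point of `L(k')` fixed by (an action realising) `τ` lies in `L(k)`. [folklore] -/
theorem mem_subfieldPoints_adjoin_v_of_act_eq
    (act : absoluteGaloisGroup ℚ_[2] → (genFibΩ 2 M).toAffine.Point → (genFibΩ 2 M).toAffine.Point)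
    (hact : ∀ σ (x y : PadicAlgCl 2) (h : (genFibΩ 2 M).toAffine.Nonsingular x y),
      ∃ h', act σ (Affine.Point.some x y h) = Affine.Point.some (σ • x) (σ • y) h')
    {N : ℕ} (hN : 2 ≤ N) {g : absoluteGaloisGroup ℚ_[2]}
    (hg : toAlgEquiv ℚ_[2] g (zeta 2 (N + 1)) = zeta 2 (N + 1) ^ (2 ^ N + (2 ^ (N + 1) - 1)))
    {Q : (genFibΩ 2 M).toAffine.Point}
    (hQ : Q ∈ subfieldPoints (genFibΩ 2 M) (ℚ_[2]⟮zeta 2 (N + 1) + (zeta 2 (N + 1))⁻¹ - 2⟯).toSubfield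
      (coeffs_mem_adjoin M _))
    (hfix : act g Q = Q) :
    Q ∈ subfieldPoints (genFibΩ 2 M) (ℚ_[2]⟮zeta 2 N + (zeta 2 N)⁻¹ - 2⟯).toSubfield (coeffs_mem_adjoin M _) := by
  rcases Q with _ | ⟨x, y, h⟩
  · exact (subfieldPoints _ _ _).zero_mem
  · obtain ⟨h', e⟩ := hact g x y h
    obtain ⟨hx, hy⟩ := (some_mem_subfieldPoints_iff _ h).mp hQ
    rw [e] at hfix
    have hxy := (Affine.Point.some.injEq _ _ _ _ _ _).mp hfix
    rw [absoluteGaloisGroup.smul_def, absoluteGaloisGroup.smul_def] at hxy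
    exact (some_mem_subfieldPoints_iff _ h).mpr
      ⟨mem_adjoin_v_of_tau_apply_eq hN hg hx hxy.1, mem_adjoin_v_of_tau_apply_eq hN hg hy hxy.2⟩

/-- **Point descent along the plus tower**: a point `Q ∈ L(ℚ₂(v_{N+1})) ∩ E₁` whose logarithm lies in `ℚ₂(v_N)` lies in
`L(ℚ₂(v_N))`, provided `L(ℚ₂(ζ_{2^{N+1}}))` has no `2`-power torsion (`N ≥ 2`). Plus analogue of
`KobayashiTowerPoints.mem_subfieldPoints_of_ptLogΩ_mem`. [cite: Kobayashi2003, Prop. 8.12] -/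
theorem mem_subfieldPoints_adjoin_v_of_ptLogΩ_mem
    (act : absoluteGaloisGroup ℚ_[2] → (genFibΩ 2 M).toAffine.Point → (genFibΩ 2 M).toAffine.Point)
    (hact0 : ∀ σ, act σ 0 = 0)
    (hact : ∀ σ (x y : PadicAlgCl 2) (h : (genFibΩ 2 M).toAffine.Nonsingular x y),
      ∃ h', act σ (Affine.Point.some x y h) = Affine.Point.some (σ • x) (σ • y) h')
    {N : ℕ} (hN : 2 ≤ N)
    (htors : ∀ Q ∈ subfieldPoints (genFibΩ 2 M) (layer 2 (N + 1)).toSubfield coeffs_mem_layer, ∀ k : ℕ, 2 ^ k • Q = 0 → Q = 0)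
    {Q : (genFibΩ 2 M).toAffine.Point}
    (hQ : Q ∈ subfieldPoints (genFibΩ 2 M) (ℚ_[2]⟮zeta 2 (N + 1) + (zeta 2 (N + 1))⁻¹ - 2⟯).toSubfield
      (coeffs_mem_adjoin M _))
    (hQk : Q ∈ kernel (Valued.v (R := PadicAlgCl 2)) (genFibΩ 2 M))
    (hΛ : ptLogΩ 2 M Q ∈ ℚ_[2]⟮zeta 2 N + (zeta 2 N)⁻¹ - 2⟯) :
    Q ∈ subfieldPoints (genFibΩ 2 M) (ℚ_[2]⟮zeta 2 N + (zeta 2 N)⁻¹ - 2⟯).toSubfield (coeffs_mem_adjoin M _) := by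
  haveI := isIntegral_curveK 2 (LayerField 2 (N + 1)) M
  have hle : (ℚ_[2]⟮zeta 2 (N + 1) + (zeta 2 (N + 1))⁻¹ - 2⟯).toSubfield ≤ (layer 2 (N + 1)).toSubfield :=
    adjoin_v_le_layer (N + 1)
  obtain ⟨τ, hτ⟩ := exists_tau (by omega : 1 ≤ N)
  set g : absoluteGaloisGroup ℚ_[2] := (toAlgEquiv ℚ_[2]).symm τ with hg
  have hgτ : toAlgEquiv ℚ_[2] g = τ := by rw [hg, MulEquiv.apply_symm_apply]
  refine mem_subfieldPoints_adjoin_v_of_act_eq act hact hN (g := g) (by rw [hgτ]; exact hτ) hQ ?_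
  -- `D = act g Q − Q` has `Λ(D) = 0`, hence is `2`-power torsion, hence `0`
  have hgQL : act g Q ∈ subfieldPoints (genFibΩ 2 M) (ℚ_[2]⟮zeta 2 (N + 1) + (zeta 2 (N + 1))⁻¹ - 2⟯).toSubfield
      (coeffs_mem_adjoin M _) :=
    act_mem_subfieldPoints_adjoin_v act hact0 hact g (by omega : 2 ≤ N + 1) hQ
  have hgQk : act g Q ∈ kernel (Valued.v (R := PadicAlgCl 2)) (genFibΩ 2 M) := act_mem_kernel act hact0 hact g hQk
  have hDL : act g Q - Q ∈ subfieldPoints (genFibΩ 2 M) (layer 2 (N + 1)).toSubfield coeffs_mem_layer :=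
    (subfieldPoints _ _ _).sub_mem (mem_subfieldPoints_of_le _ coeffs_mem_layer hle hgQL)
      (mem_subfieldPoints_of_le _ coeffs_mem_layer hle hQ)
  have hDk : act g Q - Q ∈ kernel (Valued.v (R := PadicAlgCl 2)) (genFibΩ 2 M) :=
    (kernel (Valued.v (R := PadicAlgCl 2)) (genFibΩ 2 M)).sub_mem hgQk hQk
  have hQz : ‖Q.zCoord‖ < 1 := by
    have := val_zCoord_lt_one hQk
    rwa [PadicAlgCl.valuation_def, ← NNReal.coe_lt_coe, coe_nnnorm, NNReal.coe_one] at this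
  have hΛD : ptLogΩ 2 M (act g Q - Q) = 0 := by
    rw [ptLogΩ_sub (m := N + 1) (mem_subfieldPoints_of_le _ coeffs_mem_layer hle hgQL)
      (mem_subfieldPoints_of_le _ coeffs_mem_layer hle hQ) hgQk hQk, ptLogΩ_act act hact0 hact g hQz,
      absoluteGaloisGroup.smul_def, hgτ, tau_apply_eq_self_of_mem hN hτ hΛ, sub_self]
  obtain ⟨k, hk⟩ := exists_pow_smul_eq_zero_of_ptLogΩ_eq_zero (m := N + 1) hDL hDk hΛD
  have hD0 : act g Q - Q = 0 := htors _ hDL k hk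
  exact sub_eq_zero.mp hD0

/-! ## §3 The generation step with descent -/

variable [hEt : (M.map PadicInt.toZMod).IsElliptic]

/-- **KOBAYASHI'S GENERATION STEP ALONG THE PLUS TOWER AT `p = 2`, with descent** (`N ≥ 2`, `a₂(M) = 0`, no `2`-power torsion in
`L(ℚ₂(ζ_{2^{N+1}}))`): for a plus Honda point `e ∈ L(k') ∩ E₁` (`Λ(e) − v_{N+1} ∈ k`) and every `P ∈ L(k') ∩ E₁` there are
`B ∈ ℤ[Γ·e]` and `R ∈ L(k') ∩ E₁` with **`P − B − 2•R ∈ L(k) ∩ E₁`** — «every point of `Ê(𝔪_{k'})` is an integral combination of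
conjugates of `e` modulo `Ê(𝔪_k) + 2Ê(𝔪_{k'})`». [cite: Kobayashi2003, Prop. 8.12] -/
theorem exists_sub_closure_sub_two_smul_mem_plus
    (htr : Literature.NumberTheory.EllipticCurves.HasseManin.tr (M.map PadicInt.toZMod) = 0)
    (act : absoluteGaloisGroup ℚ_[2] → (genFibΩ 2 M).toAffine.Point → (genFibΩ 2 M).toAffine.Point)
    (hact0 : ∀ σ, act σ 0 = 0)
    (hact : ∀ σ (x y : PadicAlgCl 2) (h : (genFibΩ 2 M).toAffine.Nonsingular x y),
      ∃ h', act σ (Affine.Point.some x y h) = Affine.Point.some (σ • x) (σ • y) h')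
    {N : ℕ} (hN : 2 ≤ N)
    (htors : ∀ Q ∈ subfieldPoints (genFibΩ 2 M) (layer 2 (N + 1)).toSubfield coeffs_mem_layer, ∀ k : ℕ, 2 ^ k • Q = 0 → Q = 0)
    {e : (genFibΩ 2 M).toAffine.Point}
    (heL : e ∈ subfieldPoints (genFibΩ 2 M) (ℚ_[2]⟮zeta 2 (N + 1) + (zeta 2 (N + 1))⁻¹ - 2⟯).toSubfield
      (coeffs_mem_adjoin M _))
    (hek : e ∈ kernel (Valued.v (R := PadicAlgCl 2)) (genFibΩ 2 M))
    (heℓ : ptLogΩ 2 M e - (zeta 2 (N + 1) + (zeta 2 (N + 1))⁻¹ - 2) ∈ ℚ_[2]⟮zeta 2 N + (zeta 2 N)⁻¹ - 2⟯)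
    {P : (genFibΩ 2 M).toAffine.Point}
    (hP : P ∈ subfieldPoints (genFibΩ 2 M) (ℚ_[2]⟮zeta 2 (N + 1) + (zeta 2 (N + 1))⁻¹ - 2⟯).toSubfield
      (coeffs_mem_adjoin M _))
    (hPk : P ∈ kernel (Valued.v (R := PadicAlgCl 2)) (genFibΩ 2 M)) :
    ∃ B ∈ AddSubgroup.closure (Set.range fun σ : absoluteGaloisGroup ℚ_[2] ↦ act σ e),
      ∃ R ∈ subfieldPoints (genFibΩ 2 M) (ℚ_[2]⟮zeta 2 (N + 1) + (zeta 2 (N + 1))⁻¹ - 2⟯).toSubfield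
          (coeffs_mem_adjoin M _),
        R ∈ kernel (Valued.v (R := PadicAlgCl 2)) (genFibΩ 2 M) ∧
        P - B - 2 • R ∈ subfieldPoints (genFibΩ 2 M) (ℚ_[2]⟮zeta 2 N + (zeta 2 N)⁻¹ - 2⟯).toSubfield
          (coeffs_mem_adjoin M _) ∧
        P - B - 2 • R ∈ kernel (Valued.v (R := PadicAlgCl 2)) (genFibΩ 2 M) := by
  obtain ⟨B, hB, R, hRL, hRk, hL, hk, hΛ⟩ :=
    exists_sub_closure_sub_two_smul_plus htr act hact0 hact hN heL hek heℓ hP hPk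
  exact ⟨B, hB, R, hRL, hRk, mem_subfieldPoints_adjoin_v_of_ptLogΩ_mem act hact0 hact hN htors hL hk hΛ, hk⟩

end Descent

end Summit.BirchSwinnertonDyer.BirchSwinnertonDyer.Theorems.SignedEC.PlusTower

end
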